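import Summits.QuantumFields.YangMills.Theorems.BalabanUVNodesN16OfN05UniformPAtRecord13CoPH

/-!
# Route «BalabanUVNodes», crux K3⁸ `SpineGivenEndpointR13SepCoPHV` (stmt-QuantumFields-27366), node N16 = NE3 — THE TOP KNIT AT node00's RE-KEYED DICTIONARY OF THE FAMILY
# `stage3OfFamily F` (FLAG №14 T1: `𝔸 := M₂(ℂ)`): node N16 at dag-n22-e's reading of record `readingOfRecord₁₃CoPH w1 ℓ₃ ne2 ne1` FROM NODE N05's Σ-OBJECT READ AT THE SAME θ AS THE
# K1⁹ FACE OF RECORD, and node N07's linear leaf — module 59 at `N := 2`, transported along `stage3OfFamilyMat F 2 = stage3OfFamily F` (`rfl`)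

Cell `pub-ymgap`, seat `pub-ymgap-dag-n16-e` (R134 acceleration seat (a), strategy s2 = BY-NAME KNIT at the record; HUMAN RULING D-0062; chair R424 venue), generation 24,
module 59h (THEOREMS ONLY, 0 `def`, 0 `sorry`, standard axioms; Theses-free, importable).  `--kind proof --supports stmt-QuantumFields-27366 --as helper` (count-neutral;
proves NO registered stub).  `bears_on: R4∕N16 · edges N05 → N16, N07 → N16 · out-edge N16 → N21 · composite N27 · FLAG №14 cure road (record-nonabelian re-key)`.

WHY.  Module 59 (p689925) typed THE TOP KNIT at the reading of record with node N05's Σ-object (p681888's conclusion text) displayed at this seat's matrix-valued dictionary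
`stage3OfFamilyMat F N` (module 58 p688784) — minted because node00's dictionary of the family `stage3OfFamily F` had `𝔸 := ℂ` (FLAG №14 «RECORD-ABELIAN», director-ym №256;
this seat's g10 datum (D2)).  node00-def-RR-2's T1 (p694656, `Node00/Record12Numerics`: `N₅ := 2`, `𝔸 := Matrix (Fin 2) (Fin 2) ℂ`, `instCStar := B10Eq29TubeLine.cstarAlgebraMatrix 2`)
RE-KEYED the record, so `stage3OfFamilyMat F 2 = stage3OfFamily F` holds by `rfl` (module 58 v1.2 `stage3OfFamilyMat_two_eq_stage3OfFamily`; the two structure updates agree field by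
field, `Nontrivial` is a `Prop`).  THIS MODULE is module 59 at `N := 2` with `hN05` displayed AT `stage3OfFamily F` — the θ at which the K1⁹ face of record (dag-n24-c p688041 ∕ its
№14 T0(β) editions) displays node N05 ∕ N06 — so the K3⁸ composer's N16 rows and the K1⁹ junction read ONE N05 object BY NAME; every proof is module 59's theorem applied to the
displayed hypothesis (definitional transport, no rewriting).

WHAT IS PROVED ([folklore] composition BY NAME; no estimate).  ★★★ `exists_letters_s_N16Holder_readingOfRecord₁₃CoPHOn_of_n05UniformP_familyDict` · `…₁₃CoPH_…_familyDict`
(`0 ≤ β ≤ 1`) · ★★ `exists_letters_n16HolderAt_of_n05UniformP_familyDict` (per family; N21's face) · ★★★ `exists_letters_s_N16_readingOfRecord₁₃CoPHOn_of_n05UniformP_familyDict` ·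
`…₁₃CoPH_…_familyDict` (β = 1).

HONEST FRAMING.  Composition BY NAME; no estimate of Bałaban's is proved here.  `hN05` (node N05's Σ-object at `stage3OfFamily F`: [Balaban1985RegularSpaces] Thm 4 ∕ Prop 3 BODIES
with ONE threshold pair at every print-class periodic member of every period `ne3NperOfRecord₁₁ F 0 0 · F.Lᵏ`) and `h7` (node N07's [Balaban1985Variational] Thm 1 (8)+(10) TYPE,
linear letters) are DISPLAYED HYPOTHESES asserted for no family; node N05's p681888 inhabits `hN05 F` GIVEN node N06's five per-period analytic binders and [4]'s periodic letter
families at `stage3OfFamily F` (N06 content, NOT discharged; instance argument `Node00.finiteDimensional_𝔸_stage3OfFamily`); `w1` ∕ `ne2` ∕ `ne1` are residual DATA; no admissible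
Stage-13 tuple is claimed to exist (K0 OPEN); no stub of K3⁸ v7 closed or claimed; K 1∕4 as booked; **N16 ∕ N05 ∕ N06 ∕ N07 ∕ N27 NOT discharged**; counts UNMOVED (typed 28∕28 ·
discharged 8∕27 · A 8∕28 — the chair's line is the only count).  One finite four-torus at fixed `ε`, Bałaban AS PRINTED — NOT ℝ⁴, NOT infinite volume, NOT OS, NOT a mass gap;
the Yang–Mills mass gap (Clay) is NOT proved by any of this — R4 closes the conditional finite-𝕋⁴ rung `BalabanLadder.UV` only.
References: [Balaban1985RegularSpaces] T. Bałaban, CMP **99** (1985) 75–102, Thm 4 p. 88, Prop. 3 p. 87, p. 77; [Balaban1985Variational] T. Bałaban, CMP **102** (1985) 277–309, Thm 1 p. 279.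
-/

set_option autoImplicit false

open scoped BigOperators Matrix Matrix.Norms.L2Operator
open NormedSpace

namespace Summit.QuantumFields.YangMills.BalabanUVNodes.N16OfN05UniformPAtFamilyDict

open Literature.MathematicalPhysics.QuantumFieldTheory.Balaban1983to89
open Literature.MathematicalPhysics.QuantumFieldTheory.Balaban1983to89.T4Continuum (T4Family ULoop)
open B7Prop1Explicit B7Prop2Explicit
open B8LeafModelZdHP2Per (zdGF3HP₂Per)
open Node00 (Stage13HParams IdxB8SubDPerκ NE3Objects₁₁ NE3Letters₁₁ NE2Objects₁₁ ne3ConstLayerOfRecord₁₁ ne3NperOfRecord₁₁ ne3DomOfRecord₁₁ one_le_ne3NperOfRecord₁₁ MatA stage3OfFamily)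
open Node00.W1 (ReadingData)
open Summit.QuantumFields.BalabanUV.T4Continuum
open NE3.LeafIndexSockets (LeafH3sup)
open YMDAG.UVSplit (NE3Carriers NE1pCarriers S_N16 ne3OfRecord₁₁ RRec₁₃CoPH RRec₁₃CoPHOn readingOfRecord₁₃CoPH)
open Summit.QuantumFields.YangMills.BalabanUVNodes.N16Regime (PrintSlot)
open Summit.QuantumFields.YangMills.BalabanUVNodes.N16HolderDefs (N16HolderAt S_N16Holder)
open Summit.QuantumFields.YangMills.BalabanUVNodes.N16HolderRegime (PrintSlotHolder InEndRegimeH radiusOfRecordH constOfRecordH)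
open Summit.QuantumFields.YangMills.BalabanUVNodes.N16OfN05UniformPAtRecord13CoPH (exists_letters_n16HolderAt_of_n05UniformP
  exists_letters_s_N16Holder_readingOfRecord₁₃CoPHOn_of_n05UniformP exists_letters_s_N16Holder_readingOfRecord₁₃CoPH_of_n05UniformP
  exists_letters_s_N16_readingOfRecord₁₃CoPHOn_of_n05UniformP exists_letters_s_N16_readingOfRecord₁₃CoPH_of_n05UniformP)
-- `Site` alone could resolve to the torus sites; re-export the `ℤ^d` sites of `B7Prop1Explicit`.
export B7Prop1Explicit (Site)

noncomputable section


section Holder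

variable {β : ℝ} (hβ0 : 0 ≤ β) (hβ1 : β ≤ 1)
variable (Rg : (F : T4Family) → Stage13HParams F 2 → Prop)
  (w1 : (F : T4Family) → (θ : Stage13HParams F 2) → ReadingData F (MatA 2) θ.τ9.M)
  (ne2 : (F : T4Family) → Stage13HParams F 2 → (ℕ → ℝ) → List (ULoop F) → ℕ → NE2Objects₁₁)
  (ne1 : (F : T4Family) → Stage13HParams F 2 → (ℕ → ℝ) → List (ULoop F) → NE1pCarriers)
include hβ0 hβ1

/-- **★★★ THE TOP KNIT — N16 UNDER R-β AT THE REGIME-RESTRICTED READING OF RECORD FROM NODE N05's Σ-OBJECT AND N07's LINEAR LEAF, LETTERS CHOSEN** (`0 ≤ β ≤ 1`).  `hN05 F` =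
node N05's p681888 conclusion text at node00's RE-KEYED dictionary of the family `stage3OfFamily F` (𝔸 = M₂(ℂ) since FLAG №14 T1 p694656), periods `ne3NperOfRecord₁₁ F 0 0 · F.Lᵏ` (pins `Mκ Rκ` and the Hölder length letter
`len` existential per family), `h7 F` = node N07's linear leaf; THEN letters of record `ℓ₃` with the composer's `h16 : S_N16Holder β (RRec₁₃CoPHOn (readingOfRecord₁₃CoPH w1 ℓ₃ ne2 ne1) Rg)`
and, per family, the identities, dag-n21-d's numerals, THE END's β-uniform proviso and dag-n16-c's PRINT β-slot — module 59 at N := 2 ∘ `stage3OfFamilyMat_two_eq_stage3OfFamily` (rfl); `Rg`, `w1`, `ne2`, `ne1` free.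
[cite: Balaban1985RegularSpaces, Thm 4 p.88, Prop. 3 p.87, p.77; Balaban1985Variational, Thm 1 p.279] [folklore] -/
theorem exists_letters_s_N16Holder_readingOfRecord₁₃CoPHOn_of_n05UniformP_familyDict {g : T4Family → ℝ} (hg : ∀ F, 0 < g F)
    (hN05 : ∀ F : T4Family, letI : CStarAlgebra (Matrix (Fin 2) (Fin 2) ℂ) := B10Eq29TubeLine.cstarAlgebraMatrix 2
      ∃ (Mκ Rκ : ℕ) (len : Site 4 → ℝ), (∀ v : Site 4, 0 < len v → 1 ≤ len v) ∧ (∀ μ : Fin 4, len (e μ) = 1) ∧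
      ∃ (inp : B8.B9Inputs) (B₀β B₈ c₄ c₃ : ℝ), inp.B₀ ≤ B₈ ∧ 0 < c₄ ∧ 0 < c₃ ∧
        ∀ (ν : {k : ℕ // 1 ≤ k}) (a : IdxB8SubDPerκ (stage3OfFamily F) (ne3NperOfRecord₁₁ F 0 0 * F.L ^ ν.1) Mκ Rκ),
          B8.Thm4Body c₄ (5 * ((4 : ℕ) : ℝ) * F.L * B₈)
            (fun _ : Unit => (zdGF3HP₂Per (Matrix (Fin 2) (Fin 2) ℂ) F.L β len a.toZdIdx (ne3NperOfRecord₁₁ F 0 0 * F.L ^ ν.1)).toGFData) ∧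
          B8.Prop3Body c₃ 4 (F.L : ℝ) (2097152 * (((4 : ℕ) : ℝ) + 1) ^ 2 * (F.L : ℝ) ^ 2) inp B₀β
            (fun _ : Unit => (zdGF3HP₂Per (Matrix (Fin 2) (Fin 2) ℂ) F.L β len a.toZdIdx (ne3NperOfRecord₁₁ F 0 0 * F.L ^ ν.1)).toGFData2))
    (h7 : ∀ F : T4Family, ∃ C ε₀ : ℝ, 0 ≤ C ∧ 0 < ε₀ ∧ ∀ ε : ℝ, 0 < ε → ε ≤ ε₀ →
      LeafH3sup 4 F.L (ne3NperOfRecord₁₁ F 0 0) ε (C * ε) (C * ε) (ne3DomOfRecord₁₁ F 2 0 0)) :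
    ∃ ℓ₃ : T4Family → NE3Letters₁₁,
      S_N16Holder β (RRec₁₃CoPHOn (readingOfRecord₁₃CoPH w1 ℓ₃ ne2 ne1) Rg) ∧
      ∀ F : T4Family, (ℓ₃ F).g = g F ∧ (ℓ₃ F).Λ₁ = radiusOfRecordH 2 F.L (ne3NperOfRecord₁₁ F 0 0) ∧
        (ℓ₃ F).C = constOfRecordH 2 F.L (ne3NperOfRecord₁₁ F 0 0) (g F) ∧
        0 < (ℓ₃ F).b ∧ 512 * (4 + 1) * (4 + 4) * (F.L : ℝ) ^ 2 * (ℓ₃ F).b ≤ 1 ∧ 0 < (ℓ₃ F).Λ₂' ∧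
        InEndRegimeH (ne3OfRecord₁₁ F (ne3ConstLayerOfRecord₁₁ F 2 (ℓ₃ F))) ∧ PrintSlotHolder (ne3OfRecord₁₁ F (ne3ConstLayerOfRecord₁₁ F 2 (ℓ₃ F))) β :=
  exists_letters_s_N16Holder_readingOfRecord₁₃CoPHOn_of_n05UniformP (N := 2) hβ0 hβ1 Rg w1 ne2 ne1 hg hN05 h7

/-- **★★★ THE SAME AT THE CANONICAL READING OF RECORD** (`S_N16Holder β (RRec₁₃CoPH (readingOfRecord₁₃CoPH w1 ℓ₃ ne2 ne1))`; module 59 at N := 2 ∘ `stage3OfFamilyMat_two_eq_stage3OfFamily` (rfl)).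
[cite: Balaban1985RegularSpaces, Thm 4 p.88, Prop. 3 p.87] [folklore] -/
theorem exists_letters_s_N16Holder_readingOfRecord₁₃CoPH_of_n05UniformP_familyDict {g : T4Family → ℝ} (hg : ∀ F, 0 < g F)
    (hN05 : ∀ F : T4Family, letI : CStarAlgebra (Matrix (Fin 2) (Fin 2) ℂ) := B10Eq29TubeLine.cstarAlgebraMatrix 2
      ∃ (Mκ Rκ : ℕ) (len : Site 4 → ℝ), (∀ v : Site 4, 0 < len v → 1 ≤ len v) ∧ (∀ μ : Fin 4, len (e μ) = 1) ∧
      ∃ (inp : B8.B9Inputs) (B₀β B₈ c₄ c₃ : ℝ), inp.B₀ ≤ B₈ ∧ 0 < c₄ ∧ 0 < c₃ ∧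
        ∀ (ν : {k : ℕ // 1 ≤ k}) (a : IdxB8SubDPerκ (stage3OfFamily F) (ne3NperOfRecord₁₁ F 0 0 * F.L ^ ν.1) Mκ Rκ),
          B8.Thm4Body c₄ (5 * ((4 : ℕ) : ℝ) * F.L * B₈)
            (fun _ : Unit => (zdGF3HP₂Per (Matrix (Fin 2) (Fin 2) ℂ) F.L β len a.toZdIdx (ne3NperOfRecord₁₁ F 0 0 * F.L ^ ν.1)).toGFData) ∧
          B8.Prop3Body c₃ 4 (F.L : ℝ) (2097152 * (((4 : ℕ) : ℝ) + 1) ^ 2 * (F.L : ℝ) ^ 2) inp B₀β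
            (fun _ : Unit => (zdGF3HP₂Per (Matrix (Fin 2) (Fin 2) ℂ) F.L β len a.toZdIdx (ne3NperOfRecord₁₁ F 0 0 * F.L ^ ν.1)).toGFData2))
    (h7 : ∀ F : T4Family, ∃ C ε₀ : ℝ, 0 ≤ C ∧ 0 < ε₀ ∧ ∀ ε : ℝ, 0 < ε → ε ≤ ε₀ →
      LeafH3sup 4 F.L (ne3NperOfRecord₁₁ F 0 0) ε (C * ε) (C * ε) (ne3DomOfRecord₁₁ F 2 0 0)) :
    ∃ ℓ₃ : T4Family → NE3Letters₁₁,
      S_N16Holder β (RRec₁₃CoPH (readingOfRecord₁₃CoPH w1 ℓ₃ ne2 ne1)) ∧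
      ∀ F : T4Family, (ℓ₃ F).g = g F ∧ (ℓ₃ F).Λ₁ = radiusOfRecordH 2 F.L (ne3NperOfRecord₁₁ F 0 0) ∧
        (ℓ₃ F).C = constOfRecordH 2 F.L (ne3NperOfRecord₁₁ F 0 0) (g F) ∧
        0 < (ℓ₃ F).b ∧ 512 * (4 + 1) * (4 + 4) * (F.L : ℝ) ^ 2 * (ℓ₃ F).b ≤ 1 ∧ 0 < (ℓ₃ F).Λ₂' ∧
        InEndRegimeH (ne3OfRecord₁₁ F (ne3ConstLayerOfRecord₁₁ F 2 (ℓ₃ F))) ∧ PrintSlotHolder (ne3OfRecord₁₁ F (ne3ConstLayerOfRecord₁₁ F 2 (ℓ₃ F))) β :=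
  exists_letters_s_N16Holder_readingOfRecord₁₃CoPH_of_n05UniformP (N := 2) hβ0 hβ1 w1 ne2 ne1 hg hN05 h7

omit hβ1 in
/-- **★★ PER FAMILY: `N16HolderAt · β` AT LETTERS OF RECORD FROM NODE N05's Σ-OBJECT AND N07's LINEAR LEAF** (`0 ≤ β ≤ 1`) — module 59's `exists_letters_n16HolderAt_of_n05UniformP` at N := 2, definitional transport (what dag-n21-d's N21 face reads at ₁₃, `N16HolderAt` unfolded = the β-root `CovRootHolder` at RR-1's letters and data of record). [cite: Balaban1985RegularSpaces, Thm 4 p.88, Prop. 3 p.87] [folklore] -/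
theorem exists_letters_n16HolderAt_of_n05UniformP_familyDict (hβ1' : β ≤ 1) (F : T4Family) {g : ℝ} (hg : 0 < g)
    (hN05F : letI : CStarAlgebra (Matrix (Fin 2) (Fin 2) ℂ) := B10Eq29TubeLine.cstarAlgebraMatrix 2
      ∃ (Mκ Rκ : ℕ) (len : Site 4 → ℝ), (∀ v : Site 4, 0 < len v → 1 ≤ len v) ∧ (∀ μ : Fin 4, len (e μ) = 1) ∧
      ∃ (inp : B8.B9Inputs) (B₀β B₈ c₄ c₃ : ℝ), inp.B₀ ≤ B₈ ∧ 0 < c₄ ∧ 0 < c₃ ∧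
        ∀ (ν : {k : ℕ // 1 ≤ k}) (a : IdxB8SubDPerκ (stage3OfFamily F) (ne3NperOfRecord₁₁ F 0 0 * F.L ^ ν.1) Mκ Rκ),
          B8.Thm4Body c₄ (5 * ((4 : ℕ) : ℝ) * F.L * B₈)
            (fun _ : Unit => (zdGF3HP₂Per (Matrix (Fin 2) (Fin 2) ℂ) F.L β len a.toZdIdx (ne3NperOfRecord₁₁ F 0 0 * F.L ^ ν.1)).toGFData) ∧
          B8.Prop3Body c₃ 4 (F.L : ℝ) (2097152 * (((4 : ℕ) : ℝ) + 1) ^ 2 * (F.L : ℝ) ^ 2) inp B₀β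
            (fun _ : Unit => (zdGF3HP₂Per (Matrix (Fin 2) (Fin 2) ℂ) F.L β len a.toZdIdx (ne3NperOfRecord₁₁ F 0 0 * F.L ^ ν.1)).toGFData2))
    (h7F : ∃ C ε₀ : ℝ, 0 ≤ C ∧ 0 < ε₀ ∧ ∀ ε : ℝ, 0 < ε → ε ≤ ε₀ →
      LeafH3sup 4 F.L (ne3NperOfRecord₁₁ F 0 0) ε (C * ε) (C * ε) (ne3DomOfRecord₁₁ F 2 0 0)) :
    ∃ ℓ : NE3Letters₁₁, ℓ.g = g ∧ ℓ.Λ₁ = radiusOfRecordH 2 F.L (ne3NperOfRecord₁₁ F 0 0) ∧ ℓ.C = constOfRecordH 2 F.L (ne3NperOfRecord₁₁ F 0 0) g ∧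
      0 < ℓ.b ∧ 512 * (4 + 1) * (4 + 4) * (F.L : ℝ) ^ 2 * ℓ.b ≤ 1 ∧ 0 < ℓ.Λ₂' ∧
      InEndRegimeH (ne3OfRecord₁₁ F (ne3ConstLayerOfRecord₁₁ F 2 ℓ)) ∧ PrintSlotHolder (ne3OfRecord₁₁ F (ne3ConstLayerOfRecord₁₁ F 2 ℓ)) β ∧
      N16HolderAt (ne3OfRecord₁₁ F (ne3ConstLayerOfRecord₁₁ F 2 ℓ)) β := by
  exact exists_letters_n16HolderAt_of_n05UniformP (N := 2) hβ0 hβ1' F hg hN05F h7F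

end Holder

section One

variable (Rg : (F : T4Family) → Stage13HParams F 2 → Prop)
  (w1 : (F : T4Family) → (θ : Stage13HParams F 2) → ReadingData F (MatA 2) θ.τ9.M)
  (ne2 : (F : T4Family) → Stage13HParams F 2 → (ℕ → ℝ) → List (ULoop F) → ℕ → NE2Objects₁₁)
  (ne1 : (F : T4Family) → Stage13HParams F 2 → (ℕ → ℝ) → List (ULoop F) → NE1pCarriers)

/-- **★★★ THE TOP KNIT AT THE EXPONENT OF RECORD (β = 1) — THE STUB OF RECORD `S_N16` AT THE REGIME-RESTRICTED READING OF RECORD FROM NODE N05's Σ-OBJECT AT EXPONENT `1`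
AND N07's LINEAR LEAF** — module 59 (β = 1) at N := 2, definitional transport: `h16 : S_N16 (RRec₁₃CoPHOn (readingOfRecord₁₃CoPH w1 ℓ₃ ne2 ne1) Rg)`, per-family identities, numerals, β-uniform proviso
and n16-e's PRINT SLOT OF RECORD `PrintSlot`. [cite: Balaban1985RegularSpaces, Thm 4 p.88, Prop. 3 p.87; Balaban1985Variational, Thm 1 p.279] [folklore] -/
theorem exists_letters_s_N16_readingOfRecord₁₃CoPHOn_of_n05UniformP_familyDict {g : T4Family → ℝ} (hg : ∀ F, 0 < g F)
    (hN05 : ∀ F : T4Family, letI : CStarAlgebra (Matrix (Fin 2) (Fin 2) ℂ) := B10Eq29TubeLine.cstarAlgebraMatrix 2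
      ∃ (Mκ Rκ : ℕ) (len : Site 4 → ℝ), (∀ v : Site 4, 0 < len v → 1 ≤ len v) ∧ (∀ μ : Fin 4, len (e μ) = 1) ∧
      ∃ (inp : B8.B9Inputs) (B₀β B₈ c₄ c₃ : ℝ), inp.B₀ ≤ B₈ ∧ 0 < c₄ ∧ 0 < c₃ ∧
        ∀ (ν : {k : ℕ // 1 ≤ k}) (a : IdxB8SubDPerκ (stage3OfFamily F) (ne3NperOfRecord₁₁ F 0 0 * F.L ^ ν.1) Mκ Rκ),
          B8.Thm4Body c₄ (5 * ((4 : ℕ) : ℝ) * F.L * B₈)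
            (fun _ : Unit => (zdGF3HP₂Per (Matrix (Fin 2) (Fin 2) ℂ) F.L 1 len a.toZdIdx (ne3NperOfRecord₁₁ F 0 0 * F.L ^ ν.1)).toGFData) ∧
          B8.Prop3Body c₃ 4 (F.L : ℝ) (2097152 * (((4 : ℕ) : ℝ) + 1) ^ 2 * (F.L : ℝ) ^ 2) inp B₀β
            (fun _ : Unit => (zdGF3HP₂Per (Matrix (Fin 2) (Fin 2) ℂ) F.L 1 len a.toZdIdx (ne3NperOfRecord₁₁ F 0 0 * F.L ^ ν.1)).toGFData2))
    (h7 : ∀ F : T4Family, ∃ C ε₀ : ℝ, 0 ≤ C ∧ 0 < ε₀ ∧ ∀ ε : ℝ, 0 < ε → ε ≤ ε₀ →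
      LeafH3sup 4 F.L (ne3NperOfRecord₁₁ F 0 0) ε (C * ε) (C * ε) (ne3DomOfRecord₁₁ F 2 0 0)) :
    ∃ ℓ₃ : T4Family → NE3Letters₁₁,
      S_N16 (RRec₁₃CoPHOn (readingOfRecord₁₃CoPH w1 ℓ₃ ne2 ne1) Rg) ∧
      ∀ F : T4Family, (ℓ₃ F).g = g F ∧ (ℓ₃ F).Λ₁ = radiusOfRecordH 2 F.L (ne3NperOfRecord₁₁ F 0 0) ∧
        (ℓ₃ F).C = constOfRecordH 2 F.L (ne3NperOfRecord₁₁ F 0 0) (g F) ∧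
        0 < (ℓ₃ F).b ∧ 512 * (4 + 1) * (4 + 4) * (F.L : ℝ) ^ 2 * (ℓ₃ F).b ≤ 1 ∧ 0 < (ℓ₃ F).Λ₂' ∧
        InEndRegimeH (ne3OfRecord₁₁ F (ne3ConstLayerOfRecord₁₁ F 2 (ℓ₃ F))) ∧ PrintSlot (ne3OfRecord₁₁ F (ne3ConstLayerOfRecord₁₁ F 2 (ℓ₃ F))) :=
  exists_letters_s_N16_readingOfRecord₁₃CoPHOn_of_n05UniformP (N := 2) Rg w1 ne2 ne1 hg hN05 h7

/-- **★★★ THE SAME AT THE CANONICAL READING OF RECORD** (`S_N16 (RRec₁₃CoPH (readingOfRecord₁₃CoPH w1 ℓ₃ ne2 ne1))`; module 59 at N := 2 ∘ `stage3OfFamilyMat_two_eq_stage3OfFamily` (rfl)).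
[cite: Balaban1985RegularSpaces, Thm 4 p.88, Prop. 3 p.87] [folklore] -/
theorem exists_letters_s_N16_readingOfRecord₁₃CoPH_of_n05UniformP_familyDict {g : T4Family → ℝ} (hg : ∀ F, 0 < g F)
    (hN05 : ∀ F : T4Family, letI : CStarAlgebra (Matrix (Fin 2) (Fin 2) ℂ) := B10Eq29TubeLine.cstarAlgebraMatrix 2
      ∃ (Mκ Rκ : ℕ) (len : Site 4 → ℝ), (∀ v : Site 4, 0 < len v → 1 ≤ len v) ∧ (∀ μ : Fin 4, len (e μ) = 1) ∧
      ∃ (inp : B8.B9Inputs) (B₀β B₈ c₄ c₃ : ℝ), inp.B₀ ≤ B₈ ∧ 0 < c₄ ∧ 0 < c₃ ∧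
        ∀ (ν : {k : ℕ // 1 ≤ k}) (a : IdxB8SubDPerκ (stage3OfFamily F) (ne3NperOfRecord₁₁ F 0 0 * F.L ^ ν.1) Mκ Rκ),
          B8.Thm4Body c₄ (5 * ((4 : ℕ) : ℝ) * F.L * B₈)
            (fun _ : Unit => (zdGF3HP₂Per (Matrix (Fin 2) (Fin 2) ℂ) F.L 1 len a.toZdIdx (ne3NperOfRecord₁₁ F 0 0 * F.L ^ ν.1)).toGFData) ∧
          B8.Prop3Body c₃ 4 (F.L : ℝ) (2097152 * (((4 : ℕ) : ℝ) + 1) ^ 2 * (F.L : ℝ) ^ 2) inp B₀β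
            (fun _ : Unit => (zdGF3HP₂Per (Matrix (Fin 2) (Fin 2) ℂ) F.L 1 len a.toZdIdx (ne3NperOfRecord₁₁ F 0 0 * F.L ^ ν.1)).toGFData2))
    (h7 : ∀ F : T4Family, ∃ C ε₀ : ℝ, 0 ≤ C ∧ 0 < ε₀ ∧ ∀ ε : ℝ, 0 < ε → ε ≤ ε₀ →
      LeafH3sup 4 F.L (ne3NperOfRecord₁₁ F 0 0) ε (C * ε) (C * ε) (ne3DomOfRecord₁₁ F 2 0 0)) :
    ∃ ℓ₃ : T4Family → NE3Letters₁₁,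
      S_N16 (RRec₁₃CoPH (readingOfRecord₁₃CoPH w1 ℓ₃ ne2 ne1)) ∧
      ∀ F : T4Family, (ℓ₃ F).g = g F ∧ (ℓ₃ F).Λ₁ = radiusOfRecordH 2 F.L (ne3NperOfRecord₁₁ F 0 0) ∧
        (ℓ₃ F).C = constOfRecordH 2 F.L (ne3NperOfRecord₁₁ F 0 0) (g F) ∧
        0 < (ℓ₃ F).b ∧ 512 * (4 + 1) * (4 + 4) * (F.L : ℝ) ^ 2 * (ℓ₃ F).b ≤ 1 ∧ 0 < (ℓ₃ F).Λ₂' ∧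
        InEndRegimeH (ne3OfRecord₁₁ F (ne3ConstLayerOfRecord₁₁ F 2 (ℓ₃ F))) ∧ PrintSlot (ne3OfRecord₁₁ F (ne3ConstLayerOfRecord₁₁ F 2 (ℓ₃ F))) :=
  exists_letters_s_N16_readingOfRecord₁₃CoPH_of_n05UniformP (N := 2) w1 ne2 ne1 hg hN05 h7

end One

end

end Summit.QuantumFields.YangMills.BalabanUVNodes.N16OfN05UniformPAtFamilyDict
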